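import Literature.Computability.AlgebraicComplexity.BI17TensorCorollaryBridges
import Literature.Computability.AlgebraicComplexity.BI17FundamentalTensorInvariantProofs
import Literature.Computability.AlgebraicComplexity.QuantumFunctionalsProofs
import HarnessLib

/-!
# Bürgisser–Ikenmeyer 2017, Cor. 5.25 (`e'(⟨m⟩)`, `e'(⟨n²⟩)`, `e'(⟨n,n,n⟩)`) from Thm. 5.11 —
# PROOF (conditional bridge), with the two corner cases `m = 2`, `n = 1` proved outright

P. Bürgisser, C. Ikenmeyer, *Fundamental invariants of orbit closures*, J. Algebra **477** (2017)
390–434 = arXiv:1511.02927 [BurgisserIkenmeyer2017], §5.2, Cor. 5.25 (TeX `main.tex` L2478–2492;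
held text `paper:arxiv-1511.02927` p0022): "This follows from Theorem 5.11 and the determination of
the periods in Corollary 4.3 [`a(⟨m⟩) = 2`] and Corollary 4.6 [`a(⟨n,n,n⟩) = 1`]." THEOREMS ONLY;
sibling of the statement file `BI17FundamentalInvariantTensors.lean` (val-lit row BI2017-B, file of
record t04) and of `BI17TensorCorollaryBridges.lean`; nothing is restated, no new named fact.

* `BI2017_cor_5_25_of_thm_5_11 : BI2017_thm_5_11 → BI2017_cor_5_25` — the printed deduction, using
  the tree's proved `BI2017_thm_4_3_holds` (`a(⟨m⟩) = 2`), `BI2017_cor_4_9_unitTensor_holds`,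
  `tensorStabilizerPeriod_biMatMulTensorFin` (`a(⟨n,n,n⟩) = 1`), `isPolystableTensor_biMatMulTensorFin`
  and `BI2017_prop_5_22_holds` (`F_n(⟨n²⟩) = #even − #odd Latin cubes`).
* The typed Cor. 5.25 also covers `m = 2` in (1) and `n = 1` in (3), which lie outside the range
  `m > 2` of Thm. 5.11; these are proved here unconditionally: `e'(⟨2⟩) ≥ 1`, witnessed by
  Cayley's `2 × 2 × 2` hyperdeterminant (an `SL₂³`-invariant quartic with `Det(g·w) = χ(g)² Det(w)`
  and `Det(⟨2⟩) = 1`, `exists_hyperdet₂₂₂`), and `e'(⟨1,1,1⟩) = 1`, `F_1(⟨1,1,1⟩) ≠ 0`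
  (`tensorMinimalExponent_biMatMulTensorFin_one`, `aeval_fundInvariantTensor_biMatMulTensorFin_one_ne_zero`).

Honest framing: typed-literature proofs for the cell `val-lit`; nothing here bears on VP versus VNP.

## References

* [BurgisserIkenmeyer2017] P. Bürgisser, C. Ikenmeyer, *Fundamental invariants of orbit closures*,
  J. Algebra 477 (2017) 390–434; arXiv:1511.02927, Thm. 5.11, Prop. 5.22, Prop. 5.24, Cor. 5.25.
* A. Cayley, *On the theory of linear transformations*, Cambridge Math. J. 4 (1845) (the
  `2 × 2 × 2` hyperdeterminant); I. M. Gelfand, M. M. Kapranov, A. V. Zelevinsky, *Discriminants,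
  resultants, and multidimensional determinants*, Birkhäuser 1994, Ch. 14, Prop. 1.7.
-/

noncomputable section

open MvPolynomial Matrix

namespace Literature.Computability.AlgebraicComplexity

/-! ### Cayley's hyperdeterminant: `e'(⟨2⟩) ≥ 1` -/

section Hyperdet

/-- `((A ⊗ 1 ⊗ 1)w)_{abc} = A_{a0} w_{0bc} + A_{a1} w_{1bc}` over `[2]`. [folklore] -/
private theorem actTensor_fst_apply_two (A : Matrix (Fin 2) (Fin 2) ℂ)
    (w : Fin 2 → Fin 2 → Fin 2 → ℂ) (a b c : Fin 2) :
    actTensor A (1 : Matrix (Fin 2) (Fin 2) ℂ) (1 : Matrix (Fin 2) (Fin 2) ℂ) w a b c =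
      A a 0 * w 0 b c + A a 1 * w 1 b c := by
  simp only [actTensor_apply, Matrix.one_apply, mul_ite, mul_one, mul_zero, ite_mul, zero_mul,
    Finset.sum_ite_eq, Finset.mem_univ, if_true, Fin.sum_univ_two]

/-- `((1 ⊗ B ⊗ 1)w)_{abc} = B_{b0} w_{a0c} + B_{b1} w_{a1c}` over `[2]`. [folklore] -/
private theorem actTensor_snd_apply_two (B : Matrix (Fin 2) (Fin 2) ℂ)
    (w : Fin 2 → Fin 2 → Fin 2 → ℂ) (a b c : Fin 2) :
    actTensor (1 : Matrix (Fin 2) (Fin 2) ℂ) B (1 : Matrix (Fin 2) (Fin 2) ℂ) w a b c =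
      B b 0 * w a 0 c + B b 1 * w a 1 c := by
  simp only [actTensor_apply, Matrix.one_apply, mul_ite, mul_one, mul_zero, ite_mul, zero_mul,
    one_mul, Finset.sum_ite_irrel, Finset.sum_const_zero, Finset.sum_ite_eq, Finset.mem_univ,
    if_true, Fin.sum_univ_two]

/-- `((1 ⊗ 1 ⊗ C)w)_{abc} = C_{c0} w_{ab0} + C_{c1} w_{ab1}` over `[2]`. [folklore] -/
private theorem actTensor_thd_apply_two (C : Matrix (Fin 2) (Fin 2) ℂ)
    (w : Fin 2 → Fin 2 → Fin 2 → ℂ) (a b c : Fin 2) :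
    actTensor (1 : Matrix (Fin 2) (Fin 2) ℂ) (1 : Matrix (Fin 2) (Fin 2) ℂ) C w a b c =
      C c 0 * w a b 0 + C c 1 * w a b 1 := by
  simp only [actTensor_apply, Matrix.one_apply, mul_ite, mul_one, mul_zero, ite_mul, zero_mul,
    one_mul, Finset.sum_ite_irrel, Finset.sum_const_zero, Finset.sum_ite_eq, Finset.mem_univ,
    if_true, Fin.sum_univ_two]

/-- **Cayley's `2 × 2 × 2` hyperdeterminant** `Det`, the discriminant of the binary quadratic form
`det(x w_{0··} + y w_{1··})`, is an `SL₂³`-semi-invariant quartic on `⊗³ℂ²`: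
`Det((g₁ ⊗ g₂ ⊗ g₃)w) = (det g₁ det g₂ det g₃)² Det(w)` (for arbitrary `2 × 2` matrices), and
`Det(⟨2⟩) = 1`. [cite: BurgisserIkenmeyer2017, Thm. 4.2 (`a(2) = 2`; cf. GKZ Ch. 14 Prop. 1.7)] -/
theorem exists_hyperdet₂₂₂ :
    ∃ D : MvPolynomial (Fin 2 × Fin 2 × Fin 2) ℂ,
      (∀ (A B C : Matrix (Fin 2) (Fin 2) ℂ) (w : Fin 2 → Fin 2 → Fin 2 → ℂ),
        aeval (tensorPt (actTensor A B C w)) D =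
          (A.det * B.det * C.det) ^ 2 * aeval (tensorPt w) D) ∧
      aeval (tensorPt (unitTensor ℂ 2)) D = 1 := by
  let D : MvPolynomial (Fin 2 × Fin 2 × Fin 2) ℂ :=
    (X (0, 0, 0) * X (1, 1, 1) - X (0, 0, 1) * X (1, 1, 0) - X (0, 1, 0) * X (1, 0, 1) +
        X (0, 1, 1) * X (1, 0, 0)) ^ 2 -
      4 * ((X (0, 0, 0) * X (0, 1, 1) - X (0, 0, 1) * X (0, 1, 0)) *
        (X (1, 0, 0) * X (1, 1, 1) - X (1, 0, 1) * X (1, 1, 0)))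
  have hD : ∀ w : Fin 2 → Fin 2 → Fin 2 → ℂ, aeval (tensorPt w) D =
      (w 0 0 0 * w 1 1 1 - w 0 0 1 * w 1 1 0 - w 0 1 0 * w 1 0 1 + w 0 1 1 * w 1 0 0) ^ 2 -
        4 * ((w 0 0 0 * w 0 1 1 - w 0 0 1 * w 0 1 0) *
          (w 1 0 0 * w 1 1 1 - w 1 0 1 * w 1 1 0)) := by
    intro w
    simp only [D, map_sub, map_mul, map_pow, map_add, aeval_X, tensorPt, map_ofNat]
  have h1 : ∀ (A : Matrix (Fin 2) (Fin 2) ℂ) (w : Fin 2 → Fin 2 → Fin 2 → ℂ),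
      aeval (tensorPt (actTensor A (1 : Matrix (Fin 2) (Fin 2) ℂ) (1 : Matrix (Fin 2) (Fin 2) ℂ) w)) D =
        A.det ^ 2 * aeval (tensorPt w) D := by
    intro A w
    rw [hD, hD, Matrix.det_fin_two]
    simp only [actTensor_fst_apply_two]
    ring
  have h2 : ∀ (B : Matrix (Fin 2) (Fin 2) ℂ) (w : Fin 2 → Fin 2 → Fin 2 → ℂ),
      aeval (tensorPt (actTensor (1 : Matrix (Fin 2) (Fin 2) ℂ) B (1 : Matrix (Fin 2) (Fin 2) ℂ) w)) D =
        B.det ^ 2 * aeval (tensorPt w) D := by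
    intro B w
    rw [hD, hD, Matrix.det_fin_two]
    simp only [actTensor_snd_apply_two]
    ring
  have h3 : ∀ (C : Matrix (Fin 2) (Fin 2) ℂ) (w : Fin 2 → Fin 2 → Fin 2 → ℂ),
      aeval (tensorPt (actTensor (1 : Matrix (Fin 2) (Fin 2) ℂ) (1 : Matrix (Fin 2) (Fin 2) ℂ) C w)) D =
        C.det ^ 2 * aeval (tensorPt w) D := by
    intro C w
    rw [hD, hD, Matrix.det_fin_two]
    simp only [actTensor_thd_apply_two]
    ring
  refine ⟨D, fun A B C w => ?_, ?_⟩
  · have hsplit : actTensor A B C w =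
        actTensor A (1 : Matrix (Fin 2) (Fin 2) ℂ) (1 : Matrix (Fin 2) (Fin 2) ℂ) (actTensor (1 : Matrix (Fin 2) (Fin 2) ℂ) B (1 : Matrix (Fin 2) (Fin 2) ℂ) (actTensor (1 : Matrix (Fin 2) (Fin 2) ℂ) (1 : Matrix (Fin 2) (Fin 2) ℂ) C w)) := by
      rw [actTensor_actTensor, actTensor_actTensor]
      simp only [Matrix.mul_one, Matrix.one_mul]
    rw [hsplit, h1, h2, h3]
    ring
  · rw [hD]
    simp [unitTensor_apply]

/-- **`e'(⟨2⟩) ≥ 1`**: the exponent monoid `E'(⟨2⟩)` contains `1`, the hyperdeterminant being a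
polynomial function with `Det(g·⟨2⟩) = χ(g)^{a(⟨2⟩)·1}` (`a(⟨2⟩) = 2`, Thm. 4.3); so the minimal
positive exponent exists and is positive. [cite: BurgisserIkenmeyer2017, Cor. 5.25(1)] -/
theorem one_le_tensorMinimalExponent_unitTensor_two :
    1 ≤ tensorMinimalExponent (unitTensor ℂ 2) := by
  obtain ⟨D, hDact, hD1⟩ := exists_hyperdet₂₂₂
  have ha : tensorStabilizerPeriod (unitTensor ℂ 2) = 2 := (BI2017_thm_4_3_holds 2).2 (by norm_num)
  have h1 : (1 : ℕ) ∈ {e | e ∈ tensorExponentMonoid (unitTensor ℂ 2) ∧ 0 < e} := by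
    refine ⟨⟨D, fun g => ?_⟩, one_pos⟩
    rw [hDact, hD1, mul_one, ha, tensorChi]
    simp only [Units.val_mul, Matrix.GeneralLinearGroup.val_det_apply, mul_one]
  exact (Nat.sInf_mem (⟨1, h1⟩ : Set.Nonempty _)).2

end Hyperdet

/-! ### `⟨1,1,1⟩`: `e'(⟨1,1,1⟩) = 1` and `F_1(⟨1,1,1⟩) ≠ 0` -/

section MatMulOne

/-- `[1²]` has one element. [folklore] -/
private theorem fin_one_mul_one_eq (x : Fin (1 * 1)) : x = ⟨0, by norm_num⟩ := by
  ext
  have hx := x.2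
  simp only [mul_one, Nat.lt_one_iff] at hx
  exact hx

/-- The entry of `⟨1,1,1⟩` is `1`. [cite: BurgisserIkenmeyer2017, Prop. 5.24] -/
private theorem biMatMulTensorFin_one_apply (a b c : Fin (1 * 1)) : biMatMulTensorFin 1 ℂ a b c = 1 := by
  simp [biMatMulTensorFin, biMatMulTensor, eq_iff_true_of_subsingleton]

/-- **`e'(⟨1,1,1⟩) = 1`**: the single coordinate function `X` satisfies `X(g·⟨1,1,1⟩) =
g₁g₂g₃ = χ(g)^{a·1}` (`a(⟨1,1,1⟩) = 1`), so `1 ∈ E'(⟨1,1,1⟩)`. [cite: BurgisserIkenmeyer2017, Cor. 5.25(3)] -/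
theorem tensorMinimalExponent_biMatMulTensorFin_one :
    tensorMinimalExponent (biMatMulTensorFin 1 ℂ) = 1 := by
  set i : Fin (1 * 1) := ⟨0, by norm_num⟩ with hi
  haveI : Subsingleton (Fin (1 * 1)) := ⟨fun x y => by rw [fin_one_mul_one_eq x, fin_one_mul_one_eq y]⟩
  have ha : tensorStabilizerPeriod (biMatMulTensorFin 1 ℂ) = 1 := tensorStabilizerPeriod_biMatMulTensorFin 1
  have h1 : (1 : ℕ) ∈ {e | e ∈ tensorExponentMonoid (biMatMulTensorFin 1 ℂ) ∧ 0 < e} := by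
    refine ⟨⟨X (i, i, i), fun g => ?_⟩, one_pos⟩
    have hexp : tensorStabilizerPeriod (biMatMulTensorFin 1 ℂ) * 1 = 1 := by rw [ha]
    rw [aeval_X, hexp, pow_one, tensorChi]
    simp only [Units.val_mul, Matrix.GeneralLinearGroup.val_det_apply, tensorPt]
    rw [Matrix.det_eq_elem_of_subsingleton _ i, Matrix.det_eq_elem_of_subsingleton _ i,
      Matrix.det_eq_elem_of_subsingleton _ i, actTensor_apply]
    rw [Fintype.sum_eq_single i fun x hx => absurd (Subsingleton.elim x i) hx,
      Fintype.sum_eq_single i fun x hx => absurd (Subsingleton.elim x i) hx,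
      Fintype.sum_eq_single i fun x hx => absurd (Subsingleton.elim x i) hx,
      biMatMulTensorFin_one_apply, mul_one]
  apply le_antisymm (Nat.sInf_le h1)
  exact (Nat.sInf_mem (⟨1, h1⟩ : Set.Nonempty _)).2

/-- A family of self-maps of `[1²] = [1]` is bijective slice by slice, so its sign is a product of
units, hence nonzero. [cite: BurgisserIkenmeyer2017, §5.1 (before eq. (5.5))] -/
private theorem sliceSign_one_ne_zero (s : Fin 1 → Fin (1 * 1) → Fin (1 * 1)) : sliceSign 1 s ≠ 0 := by
  have hb : ∀ ℓ, Function.Bijective (s ℓ) := fun ℓ =>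
    ⟨fun x y _ => by rw [fin_one_mul_one_eq x, fin_one_mul_one_eq y],
      fun y => ⟨y, by rw [fin_one_mul_one_eq (s ℓ y), fin_one_mul_one_eq y]⟩⟩
  rw [sliceSign, if_pos hb]
  exact Finset.prod_ne_zero_iff.2 fun ℓ _ => Units.ne_zero _

/-- **`F_1(⟨1,1,1⟩) ≠ 0`**: for `n = 1` the sum (5.5) has the single term
`sgn_x sgn_y sgn_z · w_{000} = ±1`. [cite: BurgisserIkenmeyer2017, Cor. 5.25(3)] -/
theorem aeval_fundInvariantTensor_biMatMulTensorFin_one_ne_zero :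
    aeval (tensorPt (biMatMulTensorFin 1 ℂ)) (fundInvariantTensor 1 ℂ) ≠ 0 := by
  haveI : Unique (Fin (1 * 1)) := ⟨⟨⟨0, by norm_num⟩⟩, fun x => fin_one_mul_one_eq x⟩
  rw [aeval_fundInvariantTensor]
  simp only [Fintype.sum_unique, biMatMulTensorFin_one_apply, Finset.prod_const_one, mul_one]
  rw [Int.cast_ne_zero]
  exact mul_ne_zero (mul_ne_zero (sliceSign_one_ne_zero _) (sliceSign_one_ne_zero _))
    (sliceSign_one_ne_zero _)

end MatMulOne

/-! ### Cor. 5.25 from Thm. 5.11 -/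

section Cor525

/-- **BI 2017, Cor. 5.25(1) from Thm. 5.11(1)**: "`e'(⟨m⟩) ≥ ½⌈√m⌉` if `m > 1`", i.e.
`m ≤ 4 e'(⟨m⟩)²`: for `m > 2`, Thm. 5.11 gives `m ≤ (a e')²` with `a(⟨m⟩) = 2` (Thm. 4.3);
`m = 2` is `e'(⟨2⟩) ≥ 1` (hyperdeterminant). [cite: BurgisserIkenmeyer2017, Cor. 5.25(1)] -/
theorem BI2017_cor_5_25_part1_of_thm_5_11 (h511 : BI2017_thm_5_11) (m : ℕ) (hm : 1 < m) :
    m ≤ 4 * tensorMinimalExponent (unitTensor ℂ m) ^ 2 := by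
  by_cases h2 : m = 2
  · subst h2
    have h := one_le_tensorMinimalExponent_unitTensor_two
    nlinarith
  · have h := h511.1 m (unitTensor ℂ m) (by omega) (unitTensor_ne_zero (by omega))
      (BI2017_cor_4_9_unitTensor_holds m)
    rw [(BI2017_thm_4_3_holds m).2 hm] at h
    calc m ≤ (2 * tensorMinimalExponent (unitTensor ℂ m)) ^ 2 := h
      _ = 4 * tensorMinimalExponent (unitTensor ℂ m) ^ 2 := by ring

/-- **BI 2017, Cor. 5.25(2) from Thm. 5.11(2)**: "Let `m = n²` be even. Then `e'(⟨n²⟩) = n/2` iff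
the number of even Latin cubes of size `n` is different from the number of odd Latin cubes" —
Thm. 5.11(2) gives `a e' = n ↔ F_n(⟨n²⟩) ≠ 0` with `a(⟨n²⟩) = 2` (Thm. 4.3), and
`F_n(⟨n²⟩) = #even − #odd` (Prop. 5.22, proved). [cite: BurgisserIkenmeyer2017, Cor. 5.25(2)] -/
theorem BI2017_cor_5_25_part2_of_thm_5_11 (h511 : BI2017_thm_5_11) (n : ℕ) (hn : 2 ≤ n)
    (he : Even n) :
    tensorMinimalExponent (unitTensor ℂ (n * n)) = n / 2 ↔ latinCubeCount n ≠ 0 := by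
  have h4 : 2 * 2 ≤ n * n := Nat.mul_le_mul hn hn
  have h := (h511.2 n (unitTensor ℂ (n * n)) hn (unitTensor_ne_zero (by omega))
    (BI2017_cor_4_9_unitTensor_holds (n * n))).1
  rw [(BI2017_thm_4_3_holds (n * n)).2 (by omega), (BI2017_prop_5_22_holds n).1,
    Int.cast_ne_zero] at h
  rw [← h]
  obtain ⟨k, rfl⟩ := he
  omega

/-- **BI 2017, Cor. 5.25(3) from Thm. 5.11**: "`e'(⟨n,n,n⟩) ≥ n`, with equality holding iff
`F_n(⟨n,n,n⟩) ≠ 0`" — for `n ≥ 2`, Thm. 5.11 with `a(⟨n,n,n⟩) = 1` (Cor. 4.6) and polystability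
(Cor. 4.9); `n = 1` directly (`e'(⟨1,1,1⟩) = 1`, `F_1(⟨1,1,1⟩) ≠ 0`). [cite: BurgisserIkenmeyer2017, Cor. 5.25(3)] -/
theorem BI2017_cor_5_25_part3_of_thm_5_11 (h511 : BI2017_thm_5_11) (n : ℕ) (hn : 1 ≤ n) :
    n ≤ tensorMinimalExponent (biMatMulTensorFin n ℂ) ∧
      (tensorMinimalExponent (biMatMulTensorFin n ℂ) = n ↔
        aeval (tensorPt (biMatMulTensorFin n ℂ)) (fundInvariantTensor n ℂ) ≠ 0) := by
  by_cases h1 : n = 1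
  · subst h1
    rw [tensorMinimalExponent_biMatMulTensorFin_one]
    exact ⟨le_rfl, ⟨fun _ => aeval_fundInvariantTensor_biMatMulTensorFin_one_ne_zero, fun _ => rfl⟩⟩
  · have hn2 : 2 ≤ n := by omega
    have h4 : 2 * 2 ≤ n * n := Nat.mul_le_mul hn2 hn2
    have hne := biMatMulTensorFin_ne_zero n hn
    have hps := isPolystableTensor_biMatMulTensorFin n
    have hle := h511.1 (n * n) (biMatMulTensorFin n ℂ) (by omega) hne hps
    have hiff := (h511.2 n (biMatMulTensorFin n ℂ) hn2 hne hps).1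
    rw [tensorStabilizerPeriod_biMatMulTensorFin, one_mul] at hle hiff
    refine ⟨Nat.mul_self_le_mul_self_iff.1 ?_, hiff⟩
    simpa only [sq] using hle

/-- **BI 2017, Cor. 5.25, conditional bridge**: `BI2017_thm_5_11 → BI2017_cor_5_25` ("This follows
from Theorem 5.11 and the determination of the periods in Corollary 4.3 and Corollary 4.6",
L2488–2492; the periods, polystability and Prop. 5.22 are proved in the tree, the corners `m = 2`,
`n = 1` above). [cite: BurgisserIkenmeyer2017, Cor. 5.25] -/
theorem BI2017_cor_5_25_of_thm_5_11 (h511 : BI2017_thm_5_11) : BI2017_cor_5_25 :=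
  ⟨BI2017_cor_5_25_part1_of_thm_5_11 h511, BI2017_cor_5_25_part2_of_thm_5_11 h511,
    BI2017_cor_5_25_part3_of_thm_5_11 h511⟩

end Cor525

end Literature.Computability.AlgebraicComplexity
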